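import Summits.QuantumFields.BalabanUV.T4Continuum.Support.AveragingDeficitFermat

/-!
# AveragingDeficitTwoLevelPrep (T⁴ programme, node NE3, row NE3-R2, gen 3) — THE TWO-LEVEL CONSTRAINT MAP OF
# BAŁABAN'S COMPOSITE AVERAGE IN ITS CHART, smallness bookkeeping, small-field-ness and unitarity of the average
# (B7 Prop. 1 BY NAME), and the DECODING of the chart constraint (file 1/2 of the two-level instance of R0; file 2/2 =
# `AveragingDeficitTwoLevelFermat`)

HONEST FRAMING (cell `pub-balaban`, T4-DAG PAGE 1; unit `b2b-balaban-t4-ne3r2-p1` = owner of BINDER-OWNERS row NE3-R2,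
gen 3).  The cell's T4 target is the finite-torus continuum limit of the unit-scale averaged loop expectations — NOT
infinite volume, NO mass gap, NOT Clay, NOT summit progress.  `AveragingDeficitFermat` proved R0 (`FineCritical` for
constrained minimisers) for a constraint `Q(cavg L U) = Q(cavg L V)` with `Q` ABSTRACT.  For B11 §E's comparison of the
minimiser under the COMPOSITE (two-step) constraint with the one-step minimiser, `Q` must be the SECOND average in its
chart; THIS FILE prepares that instance, all [folklore], 0 sorry:
§1 the `𝔲(N)`-valued torus fields as an `ℝ`-submodule `skewSub d n N ≤ TDir d n N`, the fieldwise retraction `skewPF`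
(`skewPF_mem`, `skewPF_of_mem`) and its co-restriction `skewPR`, THE TWO-LEVEL CONSTRAINT MAP
`twoLevelQ L M′ W₁ W := skewPR(log((cavg L W₁)(b)⁻¹·(cavg L W)(b)))_b ∈ skewSub M′` (the `𝔲(N)` part of the chart
coordinates of the SECOND average relative to that of `W₁ = cavg L V`), its differential
`twoLevelQ' := skewPR ∘ D coord_id(0)`, `twoLevelQ_self`, `twoLevelQ_chart`;
§2 `twoLevelSmall d L = 65536(d+1)²(d+4)²L^{d+4}`, `prop1Radius d L a = L²a + 226(8(d+1)(d+4)L²a)²`,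
`smallness_of_twoLevelSmall` (lift smallness at both levels, `prop1Radius a ≤ 2L²a`), `hol_cavg_plaqWord`
(`(cavg L U)(∂p) = cplaq L Ū (L·p)`, the coarse plaquette variable (44)), **`smallField_cavg`** (the average of a
small-field configuration is small-field with radius `prop1Radius` — the tree's `B7Prop1Explicit.prop1_explicit`, B7
Prop. 1, BY NAME) and **`cavg_isUnitaryCfg`** (tree `bavg_mem_unitaryUnits` + `norm_Wcx_sub_one_le`);
§3 `eq_of_skewP_mlog_eq_zero` (for unitary `W₀, W` with `|W₀⁻¹W − 1| ≤ 1/4`: `skewP(log(W₀⁻¹W)) = 0 ⇒ W = W₀`, by the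
tree's `star_mlog_eq_neg` and `exp_mlog`) and **`cavg_cavg_eq_of_twoLevelQ_eq`** (near `V`, for unitary second
averages, the chart constraint `twoLevelQ (cavg L V) (cavg L U) = 0` IS the honest composite constraint
`cavg L (cavg L U) = cavg L (cavg L V)`, by periodicity from the torus bonds).
NE3 ITSELF IS NOT PROVED (ML, (γ2)–(γ4), δ remain; record `t4/T4-EST-NE3-P2.md` §0 (e)); NE3 stays COND-free.
CITATION HEADER: no printed sentence is a hypothesis; the manuscripts under audit are not cited for any disputed step;
context: T. Bałaban, Commun. Math. Phys. **98** (1985) 17–51 [Balaban1985Averaging] ((42) p. 23, (44) p. 24, Prop. 1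
p. 24); **102** (1985) 277–309 [Balaban1985Variational] (§E (115)–(121) p. 295).
PLACEMENT: `Summits/QuantumFields/BalabanUV/` (human rule 2026-08-19).  Record: HOME `t4/T4-EST-NE3-R2.md` v0.4.
-/

set_option autoImplicit false

open scoped BigOperators Matrix Matrix.Norms.L2Operator Topology
open NormedSpace Finset Filter

namespace Summit.QuantumFields.BalabanUV.T4Continuum.AveragingDeficitTwoLevelPrep

open Literature.MathematicalPhysics.QuantumFieldTheory.Balaban1983to89
open B7Prop1Explicit B7Prop2Explicit MatrixLog UnitaryModel
open T4AveragingDeficitWall hiding Site Plane Plaq Bond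
open T4AveragingDeficitWallBoundary (IsPeriodicCfg periodBox)
open T4AveragingDeficitNonAbelian (hol_add_period)
open AveragingDeficitTransport AveragingDeficitPlaqDeriv AveragingDeficitSideDeriv AveragingDeficitPeriodicCounting
open AveragingDeficitDerivWallProof AveragingDeficitResidualPairing AveragingDeficitFaceWords AveragingDeficitFaceLift
open AveragingDeficitLiftPeriodic
open AveragingDeficitDualResidual AveragingDeficitTorusChart AveragingDeficitChartCalculus AveragingDeficitFermat

noncomputable section

variable {d : ℕ} {n : Type*} [Fintype n] [DecidableEq n]

local notation "𝕄" => Matrix n n ℂ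
local notation "Site" => B7Prop1Explicit.Site

/-! ## §1 The `𝔲(N)` torus fields as a submodule; the two-level constraint map -/

variable (d n) in
/-- The `𝔲(N)`-valued torus fields as an `ℝ`-submodule of `TDir d n N`. [folklore] -/
def skewSub (N : ℕ) : Submodule ℝ (TDir d n N) where
  carrier := {Φ | ∀ (r : Fin d → Fin N) (κ : Fin d), Φ r κ ∈ skewAdjoint 𝕄}
  add_mem' := fun {a b} ha hb r κ => (skewAdjoint 𝕄).add_mem (ha r κ) (hb r κ)
  zero_mem' := fun _ _ => (skewAdjoint 𝕄).zero_mem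
  smul_mem' := fun c Φ hΦ r κ => by
    simp only [Pi.smul_apply]
    exact skewAdjoint.smul_mem c (hΦ r κ)

omit [Fintype n] [DecidableEq n] in
/-- Membership in `skewSub`. [folklore] -/
theorem mem_skewSub {N : ℕ} {Φ : TDir d n N} : Φ ∈ skewSub d n N ↔ ∀ (r : Fin d → Fin N) (κ : Fin d), Φ r κ ∈ skewAdjoint 𝕄 :=
  Iff.rfl

/-- The fieldwise retraction onto `𝔲(N)` as a linear map. [folklore] -/
def skewPFₗ (N : ℕ) : TDir d n N →ₗ[ℝ] TDir d n N where
  toFun Φ := fun r κ => skewP (Φ r κ)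
  map_add' Φ Ψ := by funext r κ; simp only [Pi.add_apply, map_add]
  map_smul' c Φ := by funext r κ; simp only [Pi.smul_apply, map_smul, RingHom.id_apply]

/-- The fieldwise retraction onto `𝔲(N)`, `(skewPF Φ)(r,κ) = skewP (Φ(r,κ))`. [folklore] -/
def skewPF (N : ℕ) : TDir d n N →L[ℝ] TDir d n N := LinearMap.toContinuousLinearMap (skewPFₗ N)

omit [DecidableEq n] in
/-- `skewPF` evaluated. [folklore] -/
@[simp] theorem skewPF_apply (N : ℕ) (Φ : TDir d n N) (r : Fin d → Fin N) (κ : Fin d) :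
    skewPF N Φ r κ = skewP (Φ r κ) := rfl

omit [DecidableEq n] in
/-- `skewPF` lands in `skewSub`. [folklore] -/
theorem skewPF_mem (N : ℕ) (Φ : TDir d n N) : skewPF N Φ ∈ skewSub d n N := fun r κ => skewP_mem (Φ r κ)

omit [DecidableEq n] in
/-- `skewPF` is the identity on `skewSub`. [folklore] -/
theorem skewPF_of_mem {N : ℕ} {Φ : TDir d n N} (hΦ : Φ ∈ skewSub d n N) : skewPF N Φ = Φ := by
  funext r κ
  exact skewP_of_mem (hΦ r κ)

/-- `skewPF` co-restricted to `skewSub`. [folklore] -/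
def skewPR (N : ℕ) : TDir d n N →L[ℝ] ↥(skewSub d n N) := (skewPF N).codRestrict (skewSub d n N) (skewPF_mem N)

/-- **THE TWO-LEVEL CONSTRAINT MAP**: the `𝔲(N)` part of the chart coordinates of the SECOND average of the coarse
configuration `W` relative to that of `W₁` — `twoLevelQ L M′ W₁ W = skewPF(log((cavg L W₁)(b)⁻¹ · (cavg L W)(b)))_b`,
`b` over the bonds of the level-2 torus `[0,M′)^d`.  For `W` near `W₁` with both second averages unitary, `twoLevelQ W =
twoLevelQ W₁ (= 0)` iff `cavg L W = cavg L W₁` (§3). [cite: Balaban1985Variational, (115)–(121) p.295] -/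
def twoLevelQ (L M' : ℕ) (W₁ W : Site d → Fin d → 𝕄ˣ) : ↥(skewSub d n M') :=
  skewPR M' (relLog M' (cavg L W₁) (cavg L W))

/-- The differential of the two-level constraint map in the chart at `W₁`: `skewPR ∘ D coord_id(0)`. [folklore] -/
def twoLevelQ' (L M' : ℕ) [NeZero (L * M')] (W₁ : Site d → Fin d → 𝕄ˣ) : TDir d n (L * M') →L[ℝ] ↥(skewSub d n M') :=
  (skewPR M').comp (fderiv ℝ (coord (ContinuousLinearMap.id ℝ 𝕄) L M' W₁) 0)

/-- `twoLevelQ W₁ W₁ = 0`. [folklore] -/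
theorem twoLevelQ_self (L M' : ℕ) (W₁ : Site d → Fin d → 𝕄ˣ) : twoLevelQ L M' W₁ W₁ = (0 : ↥(skewSub d n M')) := by
  simp only [twoLevelQ, relLog_self, map_zero]

/-- In the chart at `W₁` the two-level constraint map is `skewPR ∘ coord_id`. [folklore] -/
theorem twoLevelQ_chart (L M' : ℕ) [NeZero (L * M')] (W₁ : Site d → Fin d → 𝕄ˣ) (Φ : TDir d n (L * M')) :
    twoLevelQ L M' W₁ (chart (ContinuousLinearMap.id ℝ 𝕄) (L * M') W₁ Φ)
      = skewPR M' (coord (ContinuousLinearMap.id ℝ 𝕄) L M' W₁ Φ) := rfl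

/-! ## §2 Smallness bookkeeping; the averaged configuration is small-field (B7 Prop. 1 BY NAME) and unitary -/

/-- The two-level smallness constant `65536(d+1)²(d+4)²L^{d+4}` (dominates `liftSmall`, `2L²·liftSmall`, the B7 constant
`512(d+1)(d+4)L²` at both levels, and `14464(d+1)²(d+4)²L²`). [folklore] -/
def twoLevelSmall (d L : ℕ) : ℝ := 65536 * ((d : ℝ) + 1) ^ 2 * ((d : ℝ) + 4) ^ 2 * (L : ℝ) ^ (d + 4)

/-- B7 Prop. 1's output radius `L²a + 226(8(d+1)(d+4)L²a)²`. [cite: Balaban1985Averaging, Prop. 1 p.24] -/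
def prop1Radius (d L : ℕ) (a : ℝ) : ℝ := (L : ℝ) ^ 2 * a + 226 * (8 * ((d : ℝ) + 1) * ((d : ℝ) + 4) * (L : ℝ) ^ 2 * a) ^ 2

omit [Fintype n] [DecidableEq n] in
/-- **Smallness bookkeeping**: under `twoLevelSmall d L·x ≤ 1`, `0 ≤ x`, `1 ≤ L`: the lift smallness `liftSmall d L·x ≤ 1`,
the Prop. 1 radius is at most `2L²x`, and the lift smallness ONE LEVEL UP `liftSmall d L·(prop1Radius x) ≤ 1`. [folklore] -/
theorem smallness_of_twoLevelSmall {L : ℕ} (hL : 1 ≤ L) {x : ℝ} (hx : 0 ≤ x) (h : twoLevelSmall d L * x ≤ 1) :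
    liftSmall d L * x ≤ 1 ∧ 0 ≤ prop1Radius d L x ∧ prop1Radius d L x ≤ 2 * (L : ℝ) ^ 2 * x
      ∧ liftSmall d L * prop1Radius d L x ≤ 1 := by
  have hL1 : (1 : ℝ) ≤ L := by exact_mod_cast hL
  have hLd : (1 : ℝ) ≤ (L : ℝ) ^ d := one_le_pow₀ hL1
  have hL2 : (1 : ℝ) ≤ (L : ℝ) ^ 2 := one_le_pow₀ hL1
  have hd0 : (0 : ℝ) ≤ d := Nat.cast_nonneg d
  have hD : (4 : ℝ) ≤ ((d : ℝ) + 1) * ((d : ℝ) + 4) := by nlinarith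
  unfold twoLevelSmall at h
  have hpow : (L : ℝ) ^ (d + 4) = (L : ℝ) ^ d * (L : ℝ) ^ 2 * (L : ℝ) ^ 2 := by ring
  rw [hpow] at h
  -- the basic product `X = (d+1)(d+4) L² x ≤ 1/512`
  set X : ℝ := ((d : ℝ) + 1) * ((d : ℝ) + 4) * (L : ℝ) ^ 2 * x with hX
  have hX0 : 0 ≤ X := by positivity
  have hXd : 0 ≤ (L : ℝ) ^ d * X := by positivity
  have h1 : 65536 * (((d : ℝ) + 1) * ((d : ℝ) + 4)) * ((L : ℝ) ^ d * (L : ℝ) ^ 2) * X ≤ 1 := by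
    have : 65536 * (((d : ℝ) + 1) * ((d : ℝ) + 4)) * ((L : ℝ) ^ d * (L : ℝ) ^ 2) * X
        = 65536 * ((d : ℝ) + 1) ^ 2 * ((d : ℝ) + 4) ^ 2 * ((L : ℝ) ^ d * (L : ℝ) ^ 2 * (L : ℝ) ^ 2) * x := by
      rw [hX]; ring
    rw [this]; exact h
  have hD1 : (1 : ℝ) ≤ ((d : ℝ) + 1) * ((d : ℝ) + 4) := by linarith
  have hDL : (1 : ℝ) ≤ ((d : ℝ) + 1) * ((d : ℝ) + 4) * (L : ℝ) ^ 2 := one_le_mul_of_one_le_of_one_le hD1 hL2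
  have hLL : (1 : ℝ) ≤ (L : ℝ) ^ d * (L : ℝ) ^ 2 := one_le_mul_of_one_le_of_one_le hLd hL2
  -- `65536 L^d X ≤ 1`
  have hA : 65536 * ((L : ℝ) ^ d * X) ≤ 1 := by
    have hle : (L : ℝ) ^ d * X * 1 ≤ (L : ℝ) ^ d * X * (((d : ℝ) + 1) * ((d : ℝ) + 4) * (L : ℝ) ^ 2) :=
      mul_le_mul_of_nonneg_left hDL hXd
    have e : 65536 * (((d : ℝ) + 1) * ((d : ℝ) + 4)) * ((L : ℝ) ^ d * (L : ℝ) ^ 2) * X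
        = 65536 * ((L : ℝ) ^ d * X * (((d : ℝ) + 1) * ((d : ℝ) + 4) * (L : ℝ) ^ 2)) := by ring
    rw [e] at h1
    linarith
  -- `65536 D X ≤ 1`
  have hB : 65536 * ((((d : ℝ) + 1) * ((d : ℝ) + 4)) * X) ≤ 1 := by
    have hDX : 0 ≤ (((d : ℝ) + 1) * ((d : ℝ) + 4)) * X := by positivity
    have hle : (((d : ℝ) + 1) * ((d : ℝ) + 4)) * X * 1 ≤ (((d : ℝ) + 1) * ((d : ℝ) + 4)) * X * ((L : ℝ) ^ d * (L : ℝ) ^ 2) :=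
      mul_le_mul_of_nonneg_left hLL hDX
    have e : 65536 * (((d : ℝ) + 1) * ((d : ℝ) + 4)) * ((L : ℝ) ^ d * (L : ℝ) ^ 2) * X
        = 65536 * ((((d : ℝ) + 1) * ((d : ℝ) + 4)) * X * ((L : ℝ) ^ d * (L : ℝ) ^ 2)) := by ring
    rw [e] at h1
    linarith
  -- `65536 L^d L² X ≤ 1`
  have hC : 65536 * (((L : ℝ) ^ d * (L : ℝ) ^ 2) * X) ≤ 1 := by
    have hLX : 0 ≤ ((L : ℝ) ^ d * (L : ℝ) ^ 2) * X := by positivity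
    have hle : ((L : ℝ) ^ d * (L : ℝ) ^ 2) * X * 1 ≤ ((L : ℝ) ^ d * (L : ℝ) ^ 2) * X * (((d : ℝ) + 1) * ((d : ℝ) + 4)) :=
      mul_le_mul_of_nonneg_left hD1 hLX
    have e : 65536 * (((d : ℝ) + 1) * ((d : ℝ) + 4)) * ((L : ℝ) ^ d * (L : ℝ) ^ 2) * X
        = 65536 * (((L : ℝ) ^ d * (L : ℝ) ^ 2) * X * (((d : ℝ) + 1) * ((d : ℝ) + 4))) := by ring
    rw [e] at h1
    linarith
  -- the radius bound `226·64·X² ≤ L² x`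
  have hrad : prop1Radius d L x ≤ 2 * (L : ℝ) ^ 2 * x := by
    unfold prop1Radius
    have e : 226 * (8 * ((d : ℝ) + 1) * ((d : ℝ) + 4) * (L : ℝ) ^ 2 * x) ^ 2 = 14464 * X * X := by rw [hX]; ring
    rw [e]
    have h3 : 14464 * ((((d : ℝ) + 1) * ((d : ℝ) + 4)) * X) ≤ 1 := by linarith
    have h4 : (L : ℝ) ^ 2 * x * (14464 * ((((d : ℝ) + 1) * ((d : ℝ) + 4)) * X)) ≤ (L : ℝ) ^ 2 * x * 1 :=
      mul_le_mul_of_nonneg_left h3 (by positivity)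
    have e2 : (L : ℝ) ^ 2 * x * (14464 * ((((d : ℝ) + 1) * ((d : ℝ) + 4)) * X)) = 14464 * X * X := by rw [hX]; ring
    rw [e2] at h4
    linarith
  refine ⟨?_, by unfold prop1Radius; positivity, hrad, ?_⟩
  · have e : liftSmall d L * x = 32768 * ((L : ℝ) ^ d * X) := by unfold liftSmall; rw [hX]; ring
    rw [e]
    linarith
  · have h5 : liftSmall d L * (2 * (L : ℝ) ^ 2 * x) ≤ 1 := by
      have e : liftSmall d L * (2 * (L : ℝ) ^ 2 * x) = 65536 * (((L : ℝ) ^ d * (L : ℝ) ^ 2) * X) := by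
        unfold liftSmall; rw [hX]; ring
      rw [e]
      exact hC
    have hmono : liftSmall d L * prop1Radius d L x ≤ liftSmall d L * (2 * (L : ℝ) ^ 2 * x) :=
      mul_le_mul_of_nonneg_left hrad (by unfold liftSmall; positivity)
    exact hmono.trans h5

/-- `U(N)` elements are in the unit-norm class `U1` (operator norm). [folklore] -/
theorem mem_U1_of_isUnitaryCfg [Nonempty n] {U : Site d → Fin d → 𝕄ˣ} (hU : IsUnitaryCfg U) (x : Site d) (κ : Fin d) :
    U x κ ∈ U1 𝕄 := mem_U1_of_unitary (hU x κ)

/-- The plaquette variables of the coarse-unit-lattice reading are the coarse plaquette variables (44) of the average: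
`(cavg L U)(∂p_{y;κκ′}) = cplaq L Ū (L·y) κ κ′`. [cite: Balaban1985Averaging, (44) p.24] -/
theorem hol_cavg_plaqWord (L : ℕ) (U : Site d → Fin d → 𝕄ˣ) (y : Site d) (κ κ' : Fin d) :
    hol (cavg L U) y (plaqWord κ κ') = cplaq L (bavg L U) ((L : ℤ) • y) κ κ' := by
  apply Units.ext
  rw [val_hol_plaqWord]
  simp only [cavg, cplaq, smul_add, Units.val_mul, mul_assoc]

/-- **THE AVERAGE IS SMALL-FIELD (B7 Prop. 1 BY NAME)**: for a `U(N)`-valued `U` with `|U(∂p) − 1| ≤ a`,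
`512(d+1)(d+4)L²a ≤ 1`, the coarse-unit-lattice reading of its average has `|(cavg L U)(∂p) − 1| ≤ L²a + 226(8(d+1)(d+4)L²a)²`.
[cite: Balaban1985Averaging, Prop. 1 p.24] -/
theorem smallField_cavg [Nonempty n] {L : ℕ} (hL : 1 ≤ L) {U : Site d → Fin d → 𝕄ˣ} (hU : IsUnitaryCfg U) {a : ℝ} (ha : 0 ≤ a)
    (h512 : 512 * (d + 1) * (d + 4) * (L : ℝ) ^ 2 * a ≤ 1) (hUa : SmallField U a) :
    SmallField (cavg L U) (prop1Radius d L a) := by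
  intro y κ κ' hκ
  rw [hol_cavg_plaqWord]
  have h := prop1_explicit L hL ((L : ℤ) • y) hκ U (mem_U1_of_isUnitaryCfg hU) ha h512 hUa
  unfold prop1Radius
  exact h

/-- **THE AVERAGE IS UNITARY** on the coarse unit lattice (small-field class). [folklore] -/
theorem cavg_isUnitaryCfg [Nonempty n] {L : ℕ} (hL : 1 ≤ L) {U : Site d → Fin d → 𝕄ˣ} (hU : IsUnitaryCfg U) {a : ℝ} (ha : 0 ≤ a)
    (h512 : 512 * (d + 1) * (d + 4) * (L : ℝ) ^ 2 * a ≤ 1) (hUa : SmallField U a) : IsUnitaryCfg (cavg L U) := by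
  letI : CStarAlgebra 𝕄 := {}
  intro y κ
  show bavg L U ((L : ℤ) • y) κ ∈ unitaryUnits 𝕄
  refine bavg_mem_unitaryUnits (V := U) hU L _ κ fun r => ?_
  have h := norm_Wcx_sub_one_le L hL U (mem_U1_of_isUnitaryCfg hU) ha h512 hUa ((L : ℤ) • y) κ r
  have h0 : 0 ≤ ((d : ℝ) + 1) * ((d : ℝ) + 4) * (L : ℝ) ^ 2 * a := by positivity
  nlinarith

/-! ## §3 Decoding of the chart constraint -/

/-- For unitary `W₀, W` with `|W₀⁻¹W − 1| ≤ 1/4`: `skewP(log(W₀⁻¹W)) = 0 ⇒ W = W₀` (the log of a unitary in the ball is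
skew — tree `star_mlog_eq_neg` —, so it vanishes, and `W₀⁻¹W = exp(log(W₀⁻¹W)) = 1` by `exp_mlog`). [folklore] -/
theorem eq_of_skewP_mlog_eq_zero {W₀ W : 𝕄ˣ} (hW₀ : W₀ ∈ unitaryUnits 𝕄) (hW : W ∈ unitaryUnits 𝕄)
    (hnear : ‖(((W₀⁻¹ : 𝕄ˣ) : 𝕄)) * (W : 𝕄) - 1‖ ≤ 1 / 4)
    (h0 : skewP ((mlog ((((W₀⁻¹ : 𝕄ˣ) : 𝕄)) * (W : 𝕄))) : 𝕄) = 0) : W = W₀ := by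
  letI : CStarAlgebra 𝕄 := {}
  set X : 𝕄ˣ := W₀⁻¹ * W with hX
  have hXu : X ∈ unitaryUnits 𝕄 := (unitaryUnits 𝕄).mul_mem ((unitaryUnits 𝕄).inv_mem hW₀) hW
  have hXval : (X : 𝕄) = ((W₀⁻¹ : 𝕄ˣ) : 𝕄) * (W : 𝕄) := by rw [hX, Units.val_mul]
  have hnear' : ‖(X : 𝕄) - 1‖ ≤ 1 / 4 := by rw [hXval]; exact hnear
  have hskew : mlog (X : 𝕄) ∈ skewAdjoint 𝕄 := by
    rw [skewAdjoint.mem_iff]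
    exact star_mlog_eq_neg (mem_unitaryUnits.mp hXu) hnear'
  have hlog0 : mlog (X : 𝕄) = 0 := by
    rw [← skewP_of_mem hskew, hXval]
    exact h0
  have hX1 : (X : 𝕄) = 1 := by
    have h := exp_mlog (X := (X : 𝕄)) (by linarith)
    rw [hlog0, NormedSpace.exp_zero] at h
    exact h.symm
  have hXone : X = 1 := Units.ext hX1
  rw [hX] at hXone
  calc W = W₀ * (W₀⁻¹ * W) := by group
    _ = W₀ := by rw [hXone, mul_one]

/-- **NEAR `V` THE CHART CONSTRAINT IS THE HONEST TWO-LEVEL CONSTRAINT**: for unitary periodic `U` whose second average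
is unitary and bondwise within `1/4` of that of `V` (relative), `twoLevelQ (cavg L V) (cavg L U) = 0` implies
`cavg L (cavg L U) = cavg L (cavg L V)`. [folklore] -/
theorem cavg_cavg_eq_of_twoLevelQ_eq {L M' : ℕ} [NeZero M'] {V U : Site d → Fin d → 𝕄ˣ}
    (hVP2 : IsPeriodicCfg (cavg L (cavg L V)) (M' : ℤ)) (hUP2 : IsPeriodicCfg (cavg L (cavg L U)) (M' : ℤ))
    (hVu : IsUnitaryCfg (cavg L (cavg L V))) (hUu : IsUnitaryCfg (cavg L (cavg L U)))
    (hnear : ∀ (r : Fin d → Fin M') (κ : Fin d),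
      ‖(((cavg L (cavg L V) (boxVec M' r) κ)⁻¹ : 𝕄ˣ) : 𝕄) * (cavg L (cavg L U) (boxVec M' r) κ : 𝕄) - 1‖ ≤ 1 / 4)
    (hQ : twoLevelQ L M' (cavg L V) (cavg L U) = 0) : cavg L (cavg L U) = cavg L (cavg L V) := by
  have hb : ∀ (r : Fin d → Fin M') (κ : Fin d), cavg L (cavg L U) (boxVec M' r) κ = cavg L (cavg L V) (boxVec M' r) κ := by
    intro r κ
    refine eq_of_skewP_mlog_eq_zero (hVu _ _) (hUu _ _) (hnear r κ) ?_
    have h := congrArg (fun Ψ : ↥(skewSub d n M') => (Ψ : TDir d n M') r κ) hQ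
    simpa [twoLevelQ, skewPR, relLog] using h
  funext y κ
  rw [eq_wrap_add M' y, periodic_smul_vec (f := fun z => cavg L (cavg L U) z κ) (fun z i => hUP2 z i κ),
    periodic_smul_vec (f := fun z => cavg L (cavg L V) z κ) (fun z i => hVP2 z i κ)]
  exact hb _ _

end

end Summit.QuantumFields.BalabanUV.T4Continuum.AveragingDeficitTwoLevelPrep
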